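import Mathlib
import HarnessLib
import Summits.HubbardSuperconductivity.HubbardSuperconductivity.Theorems.KLProgrammeC4aCausticAngleLayer

/-!
# Route `KLProgramme` — crux C4a, S3 brick (B4) «(B4)-UMK1», (N2) the PRE-CAUSTIC LOOP-ANGLE LAYER: integrating the per-line pre-caustic law
# `A₁·lo/max(D(v),lo)² + A₂·|v − v*|/D(v) + A₃` over a fold window with `D(v) ≥ δ₀ + c(v − v*)²` gives `(32/3)·A₁·lo/(√c·m₀^{3/2}) + (8/c)·A₂·log((√c·L + √δ₀)/√δ₀) + A₃·L`,
# `m₀ = max(δ₀, lo)` — the ONE-SIDED size `lo·max(δ₀,lo)^{−3/2}` (plus a logarithm) that the caustic pair layer consumes on the pre side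

Cell `gate-hubbard-kl`, seat hubbard-kl-k3c3-p3 (g28; row «implicit-function / monotonicity route for μ(n)»).  Located brick for the (C)-closer lane hubbard-kl-c4a-1
(stub (C) `stub_twoLeg_curvature` of `KLRegimeEngineV17F2`, stmt-HubbardSuperconductivity-20437), memo HOME/hubbard-kl-k3c3-p3/U1-CAUSTIC-SUP.md §4 (N2).
Upstream: `…C4aPreCausticLevelLine.abs_intervalIntegral_deformed_antidiagonal_le` bounds the first-order jet along the level line at loop angle `v` by
`X₀·A_fl(D(v)) + W(32X₀η(v)/D(v) + 4X₁)` (split currency), with the kernel's anti-diagonal flatness number `A_fl(D) ≤ A·lo/max(D,lo)²` and the rate defect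
`η(v) ≤ η₁D(v) + η₂|v − v*|`; i.e. the shape `A₁·lo/max(D(v),lo)² + A₂|v − v*|/D(v) + A₃` of this file's hypothesis, where `D(v) = e₀ + ē(e₀,v) ≥ δ₀ + c(v − v*)²` is the
anti-diagonal level at angle `v` (fold floor `c` from `…C4aFoldCurvaturePartnerBand`, `δ₀ > 0` = pre-caustic).  Downstream: the output `lo·max(δ₀,lo)^{−3/2}`-term is the
`A`-hypothesis of `…C4aCausticPairLayer.intervalIntegral_caustic_pair_le` (pre side); the logarithm goes to its remainder (a `log⁺`-remainder twin of the pair layer is the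
successor item (w49)).
* §1 majorants in the distance `x = |v − v*|`: `angle_pre_majorant_le` (`lo/max(δ₀ + cx², lo)² ≤ 16lo/(√c·x + √m₀)⁴`), `angle_defect_majorant_le` (`x/(δ₀ + cx²) ≤ (4/√c)/(√c·x + √δ₀)`),
  and their integrals on `[0, L]` by the fundamental theorem of calculus: `≤ (16/3)·lo/(√c·m₀·√m₀)` and `= (4/c)·log((√c·L + √δ₀)/√δ₀)`;
* §2 **`intervalIntegral_pre_caustic_angle_le`**: `F ≥ 0` on `[α, β] ∋ v*` with the per-line law ⟹
  `∫_α^β F ≤ 2·A₁·(16/3)·lo/(√c·m₀·√m₀) + 2·A₂·(4/c)·log((√c(β−α) + √δ₀)/√δ₀) + A₃(β − α)`.  No integrability hypothesis on `F`.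
Pure real analysis; nothing about the model; nothing asserts (C), K3 or superconductivity.
References: Salmhofer 1999 §4.5.3 [cite: Salmhofer1999]; FST II CPAM 51 (1998) §3 [cite: FeldmanSalmhoferTrubowitz1998].
-/

noncomputable section

namespace Summit.HubbardSuperconductivity.HubbardSuperconductivity.Theorems.C4a

set_option linter.dupNamespace false -- summit = problem name (single-conjunct summit), D-0017

open Real Set MeasureTheory intervalIntegral

/-! ## §1 Majorants in the distance to the fold angle -/

/-- **Pre-side angular majorant**: `0 < lo`, `0 < c`, `0 ≤ δ₀`, `0 ≤ x`, `δ₀ + c x² ≤ D` ⟹ `lo/(max D lo)² ≤ 16·lo/(√c·x + √(max δ₀ lo))⁴`. -/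
theorem angle_pre_majorant_le {lo c δ₀ x D : ℝ} (hlo : 0 < lo) (hc : 0 < c) (hδ₀ : 0 ≤ δ₀) (hx : 0 ≤ x) (hD : δ₀ + c * x ^ 2 ≤ D) :
    lo / (max D lo) ^ 2 ≤ 16 * lo / (Real.sqrt c * x + Real.sqrt (max δ₀ lo)) ^ 4 := by
  set M := max D lo with hM
  set m₀ := max δ₀ lo with hm₀
  have hMpos : 0 < M := lt_max_of_lt_right hlo
  have hm₀pos : 0 < m₀ := lt_max_of_lt_right hlo
  have h1 : Real.sqrt c * x ≤ Real.sqrt M := by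
    have : Real.sqrt (c * x ^ 2) = Real.sqrt c * x := by rw [Real.sqrt_mul hc.le, Real.sqrt_sq hx]
    rw [← this]
    refine Real.sqrt_le_sqrt (le_trans ?_ (le_max_left _ _))
    nlinarith
  have h2 : Real.sqrt m₀ ≤ Real.sqrt M := by
    refine Real.sqrt_le_sqrt (max_le ?_ (le_max_right _ _))
    exact le_trans (by nlinarith) ((le_max_left _ _ : D ≤ M))
  have hq : Real.sqrt c * x + Real.sqrt m₀ ≤ 2 * Real.sqrt M := by linarith
  have hqpos : 0 < Real.sqrt c * x + Real.sqrt m₀ := by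
    have := Real.sqrt_pos.2 hm₀pos; have : 0 ≤ Real.sqrt c * x := by positivity
    linarith
  have hM2 : M ^ 2 = Real.sqrt M ^ 4 := by
    rw [show (4 : ℕ) = 2 * 2 from rfl, pow_mul, Real.sq_sqrt hMpos.le]
  rw [hM2, div_le_div_iff₀ (by positivity) (by positivity)]
  have h3 : (Real.sqrt c * x + Real.sqrt m₀) ^ 4 ≤ (2 * Real.sqrt M) ^ 4 := pow_le_pow_left₀ hqpos.le hq 4
  nlinarith [h3, hlo]

/-- **Defect angular majorant**: `0 < c`, `0 < δ₀`, `0 ≤ x`, `δ₀ + c x² ≤ D` ⟹ `x/D ≤ (4/√c)/(√c·x + √δ₀)`. -/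
theorem angle_defect_majorant_le {c δ₀ x D : ℝ} (hc : 0 < c) (hδ₀ : 0 < δ₀) (hx : 0 ≤ x) (hD : δ₀ + c * x ^ 2 ≤ D) :
    x / D ≤ 4 / Real.sqrt c / (Real.sqrt c * x + Real.sqrt δ₀) := by
  have hsc : 0 < Real.sqrt c := Real.sqrt_pos.2 hc
  have hsδ : 0 < Real.sqrt δ₀ := Real.sqrt_pos.2 hδ₀
  have hDpos : 0 < D := lt_of_lt_of_le (by positivity) hD
  have hq : 0 < Real.sqrt c * x + Real.sqrt δ₀ := by
    have : 0 ≤ Real.sqrt c * x := by positivity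
    linarith
  -- `(√c x + √δ₀)² ≤ 2(c x² + δ₀) ≤ 2D`, and `√c·x ≤ √c x + √δ₀`
  have h1 : (Real.sqrt c * x + Real.sqrt δ₀) ^ 2 ≤ 2 * D := by
    have hcs : Real.sqrt c ^ 2 = c := Real.sq_sqrt hc.le
    have hds : Real.sqrt δ₀ ^ 2 = δ₀ := Real.sq_sqrt hδ₀.le
    nlinarith [sq_nonneg (Real.sqrt c * x - Real.sqrt δ₀), hcs, hds]
  rw [div_le_div_iff₀ hDpos hq]
  -- `x (√c x + √δ₀) ≤ (4/√c) D`:  `√c·x·(√c x+√δ₀) ≤ (√cx+√δ₀)² ≤ 2D`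
  have h2 : Real.sqrt c * x * (Real.sqrt c * x + Real.sqrt δ₀) ≤ 2 * D := by
    have : Real.sqrt c * x ≤ Real.sqrt c * x + Real.sqrt δ₀ := by linarith
    nlinarith [this, hq]
  have h3 : x * (Real.sqrt c * x + Real.sqrt δ₀) ≤ 2 * D / Real.sqrt c := by
    rw [le_div_iff₀ hsc]; nlinarith [h2]
  calc x * (Real.sqrt c * x + Real.sqrt δ₀) ≤ 2 * D / Real.sqrt c := h3
    _ ≤ 4 / Real.sqrt c * D := by rw [div_mul_eq_mul_div, div_le_div_iff_of_pos_right hsc]; linarith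

/-- **The pre-side angular majorant integrates to `≤ (16/3)·lo/(√c·m₀·√m₀)`** on `[0, L]`, `m₀ = max δ₀ lo`. -/
theorem intervalIntegral_angle_pre_majorant_le {lo c δ₀ L : ℝ} (hlo : 0 < lo) (hc : 0 < c) (hL : 0 ≤ L) :
    ∫ x in (0 : ℝ)..L, 16 * lo / (Real.sqrt c * x + Real.sqrt (max δ₀ lo)) ^ 4 ≤
      16 * lo / (3 * Real.sqrt c * (max δ₀ lo * Real.sqrt (max δ₀ lo))) := by
  set m₀ := max δ₀ lo with hm₀
  have hm₀pos : 0 < m₀ := lt_max_of_lt_right hlo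
  have hsc : 0 < Real.sqrt c := Real.sqrt_pos.2 hc
  have hsm : 0 < Real.sqrt m₀ := Real.sqrt_pos.2 hm₀pos
  set G : ℝ → ℝ := fun x => -(16 * lo / (3 * Real.sqrt c)) * ((Real.sqrt c * x + Real.sqrt m₀) ^ 3)⁻¹ with hG
  have hq : ∀ x ∈ uIcc 0 L, 0 < Real.sqrt c * x + Real.sqrt m₀ := fun x hx => by
    rw [uIcc_of_le hL] at hx
    have : 0 ≤ Real.sqrt c * x := mul_nonneg hsc.le hx.1
    linarith
  have hderiv : ∀ x ∈ uIcc 0 L, HasDerivAt G (16 * lo / (Real.sqrt c * x + Real.sqrt m₀) ^ 4) x := fun x hx => by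
    have hqx := hq x hx
    have h1 : HasDerivAt (fun x : ℝ => Real.sqrt c * x + Real.sqrt m₀) (Real.sqrt c) x := by
      simpa using ((hasDerivAt_id x).const_mul (Real.sqrt c)).add_const (Real.sqrt m₀)
    have h2' := (hasDerivAt_pow 3 (Real.sqrt c * x + Real.sqrt m₀)).comp x h1
    have h2 : HasDerivAt (fun y : ℝ => (Real.sqrt c * y + Real.sqrt m₀) ^ 3)
        (3 * (Real.sqrt c * x + Real.sqrt m₀) ^ 2 * Real.sqrt c) x := by
      simpa [Function.comp_def] using h2'
    have h3 : HasDerivAt (fun y : ℝ => ((Real.sqrt c * y + Real.sqrt m₀) ^ 3)⁻¹)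
        (-(3 * (Real.sqrt c * x + Real.sqrt m₀) ^ 2 * Real.sqrt c) / ((Real.sqrt c * x + Real.sqrt m₀) ^ 3) ^ 2) x :=
      h2.inv (pow_ne_zero 3 hqx.ne')
    have h4 := h3.const_mul (-(16 * lo / (3 * Real.sqrt c)))
    refine h4.congr_deriv ?_
    have hq0 : Real.sqrt c * x + Real.sqrt m₀ ≠ 0 := hqx.ne'
    field_simp
    try ring
  have hcont : ContinuousOn (fun x : ℝ => 16 * lo / (Real.sqrt c * x + Real.sqrt m₀) ^ 4) (uIcc 0 L) := by
    refine ContinuousOn.div continuousOn_const ((continuousOn_const.mul continuousOn_id).add continuousOn_const |>.pow 4) fun x hx => ?_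
    exact pow_ne_zero 4 (hq x hx).ne'
  rw [integral_eq_sub_of_hasDerivAt hderiv hcont.intervalIntegrable]
  have hG0 : G 0 = -(16 * lo / (3 * Real.sqrt c * (m₀ * Real.sqrt m₀))) := by
    have h0 : (Real.sqrt c * 0 + Real.sqrt m₀) ^ 3 = m₀ * Real.sqrt m₀ := by
      rw [mul_zero, zero_add, pow_succ, Real.sq_sqrt hm₀pos.le]
    have h1 : G 0 = -(16 * lo / (3 * Real.sqrt c)) * (m₀ * Real.sqrt m₀)⁻¹ := by
      show -(16 * lo / (3 * Real.sqrt c)) * ((Real.sqrt c * 0 + Real.sqrt m₀) ^ 3)⁻¹ = _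
      rw [h0]
    rw [h1]
    field_simp
  have hGL : G L ≤ 0 := by
    have h := hq L (by rw [uIcc_of_le hL]; exact right_mem_Icc.2 hL)
    have : 0 < ((Real.sqrt c * L + Real.sqrt m₀) ^ 3)⁻¹ := by positivity
    have : 0 < 16 * lo / (3 * Real.sqrt c) := by positivity
    show -(16 * lo / (3 * Real.sqrt c)) * ((Real.sqrt c * L + Real.sqrt m₀) ^ 3)⁻¹ ≤ 0
    nlinarith
  rw [hG0]; linarith

/-- **The defect angular majorant integrates to `(4/c)·log((√c·L + √δ₀)/√δ₀)`** on `[0, L]`. -/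
theorem intervalIntegral_angle_defect_majorant {c δ₀ L : ℝ} (hc : 0 < c) (hδ₀ : 0 < δ₀) (hL : 0 ≤ L) :
    ∫ x in (0 : ℝ)..L, 4 / Real.sqrt c / (Real.sqrt c * x + Real.sqrt δ₀) =
      4 / c * Real.log ((Real.sqrt c * L + Real.sqrt δ₀) / Real.sqrt δ₀) := by
  have hsc : 0 < Real.sqrt c := Real.sqrt_pos.2 hc
  have hsδ : 0 < Real.sqrt δ₀ := Real.sqrt_pos.2 hδ₀
  set G : ℝ → ℝ := fun x => 4 / c * Real.log (Real.sqrt c * x + Real.sqrt δ₀) with hG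
  have hq : ∀ x ∈ uIcc 0 L, 0 < Real.sqrt c * x + Real.sqrt δ₀ := fun x hx => by
    rw [uIcc_of_le hL] at hx
    have : 0 ≤ Real.sqrt c * x := mul_nonneg hsc.le hx.1
    linarith
  have hderiv : ∀ x ∈ uIcc 0 L, HasDerivAt G (4 / Real.sqrt c / (Real.sqrt c * x + Real.sqrt δ₀)) x := fun x hx => by
    have hqx := hq x hx
    have h1 : HasDerivAt (fun x : ℝ => Real.sqrt c * x + Real.sqrt δ₀) (Real.sqrt c) x := by
      simpa using ((hasDerivAt_id x).const_mul (Real.sqrt c)).add_const (Real.sqrt δ₀)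
    have h2 := (h1.log hqx.ne').const_mul (4 / c)
    refine h2.congr_deriv ?_
    have hcs : Real.sqrt c * Real.sqrt c = c := Real.mul_self_sqrt hc.le
    have h3 : 4 / c * Real.sqrt c = 4 / Real.sqrt c := by
      rw [eq_div_iff hsc.ne', mul_assoc, hcs, div_mul_cancel₀ _ hc.ne']
    calc 4 / c * (Real.sqrt c / (Real.sqrt c * x + Real.sqrt δ₀)) = 4 / c * Real.sqrt c / (Real.sqrt c * x + Real.sqrt δ₀) := by ring
      _ = 4 / Real.sqrt c / (Real.sqrt c * x + Real.sqrt δ₀) := by rw [h3]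
  have hcont : ContinuousOn (fun x : ℝ => 4 / Real.sqrt c / (Real.sqrt c * x + Real.sqrt δ₀)) (uIcc 0 L) := by
    refine ContinuousOn.div continuousOn_const ((continuousOn_const.mul continuousOn_id).add continuousOn_const) fun x hx => (hq x hx).ne'
  rw [integral_eq_sub_of_hasDerivAt hderiv hcont.intervalIntegrable]
  show 4 / c * Real.log (Real.sqrt c * L + Real.sqrt δ₀) - 4 / c * Real.log (Real.sqrt c * 0 + Real.sqrt δ₀) = _
  rw [mul_zero, zero_add, ← mul_sub, ← Real.log_div (hq L (by rw [uIcc_of_le hL]; exact right_mem_Icc.2 hL)).ne' hsδ.ne']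

/-! ## §2 The pre-caustic loop-angle layer -/

/-- **THE PRE-CAUSTIC LOOP-ANGLE LAYER.**  Window `[α, β] ∋ v*`, `0 < c`, `0 < δ₀`, `0 < lo`, `A₁, A₂, A₃ ≥ 0`; `F ≥ 0` on the window; an anti-diagonal level `D` with
`δ₀ + c(v − v*)² ≤ D v`; the per-line pre-caustic law `F v ≤ A₁·lo/(max (D v) lo)² + A₂·|v − v*|/D v + A₃`.  THEN, with `m₀ = max δ₀ lo`,
`∫_α^β F ≤ 2·A₁·(16lo/(3√c·m₀√m₀)) + 2·A₂·(4/c)·log((√c(β−α) + √δ₀)/√δ₀) + A₃(β − α)` — the one-sided size `lo·max(δ₀,lo)^{−3/2}` plus a logarithm.  No integrability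
hypothesis on `F`. -/
theorem intervalIntegral_pre_caustic_angle_le {F D : ℝ → ℝ} {α β vs c δ₀ lo A₁ A₂ A₃ : ℝ} (hvs : vs ∈ Icc α β) (hc : 0 < c) (hδ₀ : 0 < δ₀) (hlo : 0 < lo)
    (hA₁ : 0 ≤ A₁) (hA₂ : 0 ≤ A₂) (hA₃ : 0 ≤ A₃)
    (hF0 : ∀ v ∈ Icc α β, 0 ≤ F v) (hD : ∀ v ∈ Icc α β, δ₀ + c * (v - vs) ^ 2 ≤ D v)
    (hF : ∀ v ∈ Icc α β, F v ≤ A₁ * (lo / (max (D v) lo) ^ 2) + A₂ * (|v - vs| / D v) + A₃) :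
    ∫ v in α..β, F v ≤
      2 * (A₁ * (16 * lo / (3 * Real.sqrt c * (max δ₀ lo * Real.sqrt (max δ₀ lo))))) +
        2 * (A₂ * (4 / c * Real.log ((Real.sqrt c * (β - α) + Real.sqrt δ₀) / Real.sqrt δ₀))) + A₃ * (β - α) := by
  set m₀ := max δ₀ lo with hm₀
  have hm₀pos : 0 < m₀ := lt_max_of_lt_right hlo
  have hsc : 0 < Real.sqrt c := Real.sqrt_pos.2 hc
  have hsδ : 0 < Real.sqrt δ₀ := Real.sqrt_pos.2 hδ₀
  have hsm : 0 < Real.sqrt m₀ := Real.sqrt_pos.2 hm₀pos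
  have hαβ : α ≤ β := hvs.1.trans hvs.2
  -- the logarithm is nonnegative and monotone in the length
  have hlog_mono : ∀ L : ℝ, 0 ≤ L → L ≤ β - α →
      Real.log ((Real.sqrt c * L + Real.sqrt δ₀) / Real.sqrt δ₀) ≤ Real.log ((Real.sqrt c * (β - α) + Real.sqrt δ₀) / Real.sqrt δ₀) := by
    intro L hL hLle
    have h0 : 0 ≤ Real.sqrt c * L := by positivity
    have h1 : 0 < Real.sqrt c * L + Real.sqrt δ₀ := by linarith
    refine Real.log_le_log (div_pos h1 hsδ) (div_le_div_of_nonneg_right ?_ hsδ.le)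
    nlinarith [mul_le_mul_of_nonneg_left hLle hsc.le]
  have hlog0 : 0 ≤ Real.log ((Real.sqrt c * (β - α) + Real.sqrt δ₀) / Real.sqrt δ₀) := by
    refine Real.log_nonneg ?_
    rw [le_div_iff₀ hsδ]
    have h0 : 0 ≤ Real.sqrt c * (β - α) := mul_nonneg hsc.le (sub_nonneg.2 hαβ)
    linarith
  have hRHS0 : 0 ≤ 2 * (A₁ * (16 * lo / (3 * Real.sqrt c * (m₀ * Real.sqrt m₀)))) +
      2 * (A₂ * (4 / c * Real.log ((Real.sqrt c * (β - α) + Real.sqrt δ₀) / Real.sqrt δ₀))) + A₃ * (β - α) := by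
    have : 0 ≤ β - α := sub_nonneg.2 hαβ
    positivity
  by_cases hint : IntervalIntegrable F volume α β
  swap
  · rw [intervalIntegral.integral_undef hint]; exact hRHS0
  -- the majorant in the distance
  set g : ℝ → ℝ := fun x => A₁ * (16 * lo / (Real.sqrt c * x + Real.sqrt m₀) ^ 4) + A₂ * (4 / Real.sqrt c / (Real.sqrt c * x + Real.sqrt δ₀)) + A₃ with hg
  have hq₁ : ∀ x : ℝ, 0 ≤ x → 0 < Real.sqrt c * x + Real.sqrt m₀ := fun x hx => by
    have : 0 ≤ Real.sqrt c * x := by positivity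
    linarith
  have hq₂ : ∀ x : ℝ, 0 ≤ x → 0 < Real.sqrt c * x + Real.sqrt δ₀ := fun x hx => by
    have : 0 ≤ Real.sqrt c * x := by positivity
    linarith
  have hg1_cont : ∀ L : ℝ, 0 ≤ L → ContinuousOn (fun x : ℝ => 16 * lo / (Real.sqrt c * x + Real.sqrt m₀) ^ 4) (Icc 0 L) := fun L _ => by
    refine ContinuousOn.div continuousOn_const ((continuousOn_const.mul continuousOn_id).add continuousOn_const |>.pow 4) fun x hx => ?_
    exact pow_ne_zero 4 (hq₁ x hx.1).ne'
  have hg2_cont : ∀ L : ℝ, 0 ≤ L → ContinuousOn (fun x : ℝ => 4 / Real.sqrt c / (Real.sqrt c * x + Real.sqrt δ₀)) (Icc 0 L) := fun L _ => by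
    refine ContinuousOn.div continuousOn_const ((continuousOn_const.mul continuousOn_id).add continuousOn_const) fun x hx => (hq₂ x hx.1).ne'
  have hgi : ∀ L : ℝ, 0 ≤ L → IntervalIntegrable g volume 0 L := fun L hL => by
    rw [intervalIntegrable_iff_integrableOn_Icc_of_le hL]
    refine ContinuousOn.integrableOn_compact isCompact_Icc ?_
    exact (((hg1_cont L hL).const_mul A₁ |>.mono le_rfl).add ((hg2_cont L hL).const_mul A₂)).add continuousOn_const
  -- value of the majorant on `[0, L]`
  have hgval : ∀ L : ℝ, 0 ≤ L → L ≤ β - α → ∫ x in (0 : ℝ)..L, g x ≤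
      A₁ * (16 * lo / (3 * Real.sqrt c * (m₀ * Real.sqrt m₀))) +
        A₂ * (4 / c * Real.log ((Real.sqrt c * (β - α) + Real.sqrt δ₀) / Real.sqrt δ₀)) + A₃ * L := fun L hL hLle => by
    have hi1 : IntervalIntegrable (fun x : ℝ => 16 * lo / (Real.sqrt c * x + Real.sqrt m₀) ^ 4) volume 0 L := by
      rw [intervalIntegrable_iff_integrableOn_Icc_of_le hL]; exact (hg1_cont L hL).integrableOn_compact isCompact_Icc
    have hi2 : IntervalIntegrable (fun x : ℝ => 4 / Real.sqrt c / (Real.sqrt c * x + Real.sqrt δ₀)) volume 0 L := by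
      rw [intervalIntegrable_iff_integrableOn_Icc_of_le hL]; exact (hg2_cont L hL).integrableOn_compact isCompact_Icc
    simp only [hg]
    rw [intervalIntegral.integral_add ((hi1.const_mul A₁).add (hi2.const_mul A₂)) intervalIntegrable_const,
      intervalIntegral.integral_add (hi1.const_mul A₁) (hi2.const_mul A₂), intervalIntegral.integral_const_mul, intervalIntegral.integral_const_mul,
      intervalIntegral.integral_const, sub_zero, smul_eq_mul, intervalIntegral_angle_defect_majorant hc hδ₀ hL]
    have h1 := intervalIntegral_angle_pre_majorant_le (δ₀ := δ₀) hlo hc hL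
    have h2 := hlog_mono L hL hLle
    have h3 : A₁ * ∫ x in (0 : ℝ)..L, 16 * lo / (Real.sqrt c * x + Real.sqrt (max δ₀ lo)) ^ 4 ≤ A₁ * (16 * lo / (3 * Real.sqrt c * (m₀ * Real.sqrt m₀))) :=
      mul_le_mul_of_nonneg_left h1 hA₁
    have h4 : A₂ * (4 / c * Real.log ((Real.sqrt c * L + Real.sqrt δ₀) / Real.sqrt δ₀)) ≤
        A₂ * (4 / c * Real.log ((Real.sqrt c * (β - α) + Real.sqrt δ₀) / Real.sqrt δ₀)) :=
      mul_le_mul_of_nonneg_left (mul_le_mul_of_nonneg_left h2 (by positivity)) hA₂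
    nlinarith [h3, h4, mul_comm L A₃]
  -- pointwise: `F v ≤ g |v − v*|`
  have hpt : ∀ v ∈ Icc α β, ∀ x : ℝ, 0 ≤ x → x = |v - vs| → F v ≤ g x := fun v hv x hx hxe => by
    have hDv := hD v hv
    have hx2 : x ^ 2 = (v - vs) ^ 2 := by rw [hxe, sq_abs]
    rw [← hx2] at hDv
    have h1 : lo / (max (D v) lo) ^ 2 ≤ 16 * lo / (Real.sqrt c * x + Real.sqrt m₀) ^ 4 := angle_pre_majorant_le hlo hc hδ₀.le hx hDv
    have h2 : |v - vs| / D v ≤ 4 / Real.sqrt c / (Real.sqrt c * x + Real.sqrt δ₀) := by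
      rw [← hxe]; exact angle_defect_majorant_le hc hδ₀ hx hDv
    simp only [hg]
    have := hF v hv
    have h1' := mul_le_mul_of_nonneg_left h1 hA₁
    have h2' := mul_le_mul_of_nonneg_left h2 hA₂
    linarith
  -- split at the fold angle
  have hiL : IntervalIntegrable F volume α vs := hint.mono_set (by rw [uIcc_of_le hαβ, uIcc_of_le hvs.1]; exact Icc_subset_Icc le_rfl hvs.2)
  have hiR : IntervalIntegrable F volume vs β := hint.mono_set (by rw [uIcc_of_le hαβ, uIcc_of_le hvs.2]; exact Icc_subset_Icc hvs.1 le_rfl)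
  rw [← integral_add_adjacent_intervals hiL hiR]
  -- right part `[v*, β]`, `x = v − v*`
  have hright : ∫ v in vs..β, F v ≤ A₁ * (16 * lo / (3 * Real.sqrt c * (m₀ * Real.sqrt m₀))) +
      A₂ * (4 / c * Real.log ((Real.sqrt c * (β - α) + Real.sqrt δ₀) / Real.sqrt δ₀)) + A₃ * (β - vs) := by
    have hL : 0 ≤ β - vs := sub_nonneg.2 hvs.2
    have hmi : IntervalIntegrable (fun v => g (v - vs)) volume vs β := by
      have h := (hgi (β - vs) hL).comp_sub_right vs
      simp only [zero_add, sub_add_cancel] at h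
      exact h
    have hle : ∫ v in vs..β, F v ≤ ∫ v in vs..β, g (v - vs) := by
      rw [intervalIntegral.integral_of_le hvs.2, intervalIntegral.integral_of_le hvs.2]
      refine integral_mono_of_nonneg ?_ hmi.1 ?_
      · exact (ae_restrict_iff' measurableSet_Ioc).2 (Filter.Eventually.of_forall fun v hv => hF0 v ⟨hvs.1.trans hv.1.le, hv.2⟩)
      · refine (ae_restrict_iff' measurableSet_Ioc).2 (Filter.Eventually.of_forall fun v hv => ?_)
        exact hpt v ⟨hvs.1.trans hv.1.le, hv.2⟩ (v - vs) (by linarith [hv.1]) (abs_of_pos (by linarith [hv.1])).symm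
    refine hle.trans ?_
    rw [intervalIntegral.integral_comp_sub_right g vs, sub_self]
    exact hgval (β - vs) hL (by linarith [hvs.1])
  -- left part `[α, v*]`, `x = v* − v`
  have hleft : ∫ v in α..vs, F v ≤ A₁ * (16 * lo / (3 * Real.sqrt c * (m₀ * Real.sqrt m₀))) +
      A₂ * (4 / c * Real.log ((Real.sqrt c * (β - α) + Real.sqrt δ₀) / Real.sqrt δ₀)) + A₃ * (vs - α) := by
    have hL : 0 ≤ vs - α := sub_nonneg.2 hvs.1
    have hmi : IntervalIntegrable (fun v => g (vs - v)) volume α vs := by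
      have h := ((hgi (vs - α) hL).comp_sub_left vs).symm
      simpa using h
    have hle : ∫ v in α..vs, F v ≤ ∫ v in α..vs, g (vs - v) := by
      rw [intervalIntegral.integral_of_le hvs.1, intervalIntegral.integral_of_le hvs.1, integral_Ioc_eq_integral_Ioo, integral_Ioc_eq_integral_Ioo]
      refine integral_mono_of_nonneg ?_ (hmi.1.mono_set Ioo_subset_Ioc_self) ?_
      · exact (ae_restrict_iff' measurableSet_Ioo).2 (Filter.Eventually.of_forall fun v hv => hF0 v ⟨hv.1.le, hv.2.le.trans hvs.2⟩)
      · refine (ae_restrict_iff' measurableSet_Ioo).2 (Filter.Eventually.of_forall fun v hv => ?_)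
        refine hpt v ⟨hv.1.le, hv.2.le.trans hvs.2⟩ (vs - v) (by linarith [hv.2]) ?_
        rw [abs_of_neg (by linarith [hv.2]), neg_sub]
    refine hle.trans ?_
    rw [intervalIntegral.integral_comp_sub_left g vs, sub_self]
    exact hgval (vs - α) hL (by linarith [hvs.2])
  have hsum : A₃ * (β - vs) + A₃ * (vs - α) = A₃ * (β - α) := by ring
  linarith [hleft, hright, hsum]

end Summit.HubbardSuperconductivity.HubbardSuperconductivity.Theorems.C4a

end
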